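import Summits.Ventures.YMGap.Thresholds.OneLinkLevelTwoQuad
import Summits.Ventures.YMGap.Thresholds.OneLinkSDVarianceQuad
import HarnessLib

/-!
# Venture YMGap — the one-link modulus beyond first order, part 51: the level-two modulus with the SHARPER SECOND MOMENT `ω̃`
# — `K₂QT(N, R)`, every `SU(N)`, `N ≥ 3`, hypothesis-free

HONEST FRAMING: venture file of the cell `pub-ymgap` (QuantumFields programme), strong-coupling LATTICE bookkeeping for `SU(N)`
lattice Yang–Mills; nothing about the continuum or the mass gap in the Clay sense.  VERBATIM re-instantiation of
`OneLinkLevelTwoQuad` (`levelTwo_algebraWAQ`) with ONE input replaced: the second-moment scale `W = N ω̂(N,r)` of the two linear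
statistics `tr(gB)`, `tr(gΔ)` (hypotheses `F1`, `F2`) becomes `W = N ω̃(N,r)` from `OneLinkSDVarianceQuad` (the quadratic word of the
Schwinger–Dyson identity kept in `L²`): `ω̃(N,r) = (τ + r²)/4 + √((τ + r²)²/16 + r²/N²)` (`→ (r²+τ)/2` as `N → ∞`, against `ω̂ → r²`).
  `K₂QT(N,R) = C·( √((1+ω⁺)/2) + E R + 2(E+¼)ω̃ + [ 3E R² + (2E+¼)τ + (10E+½)R ω̃ ] / (½ − R) )`
(`ω⁺`, inside the A-part, keeps its `ω̂`).  Numbers (float screen of this seat): `K₂QT(10, .258) = 2.03` against `K₂Q = 2.16`; the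
bootstrap column re-instantiated the same way (`K₂BT`, next seat) is predicted to move the all-`N` `d = 4` rows to
`19/500 | 83/2000 | 11/250 | 9/200 | 91/2000` (`N ≥ 4 | 6 | 10 | 20 | 50`).  Cell note `HOME/p2/ONE-LINK-HIERARCHY.md` §15 (2′).
* `omegaTilde_nonneg`, `omegaTilde_mono`; `cov_linear_le_levelTwoQT_explicit`; `levelTwoQShape_mono`;
* `oneLinkKRModulus_levelTwoQT (hN : 3 ≤ N) (hR : R < 1/2) : OneLinkKRModulus N R (K₂QT(N,R))`.
-/

noncomputable section

open scoped Matrix ComplexConjugate BigOperators ContDiff Matrix.Norms.Frobenius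
open Matrix Complex Finset MeasureTheory ProbabilityTheory
open Literature.MathematicalPhysics.QuantumFieldTheory
open Literature.MathematicalPhysics.QuantumFieldTheory.SUNBakryEmery
open Literature.MathematicalPhysics.QuantumFieldTheory.Balaban1983to89.StrongCouplingDobrushinWindow
open Literature.MathematicalPhysics.QuantumFieldTheory.Balaban1983to89.StrongCouplingKernelWindow

namespace Summit.Ventures.YMGap.OneLinkEigen

variable {N : ℕ}

/-! ### The real-arithmetic assembly with the quadratic scale -/

/-- `0 ≤ ω̃(N, r)` for `r ≥ 0` (`N ≥ 3`). [folklore] -/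
theorem omegaTilde_nonneg (hN : 3 ≤ N) {r : ℝ} (hr : 0 ≤ r) : 0 ≤ (((r * ((r ^ 2 * (1 + r / 2 + Real.sqrt (r ^ 2 / 4 + 1 / (N : ℝ) ^ 2)) / (2 - 4 / (N : ℝ) ^ 2)) / 2 + Real.sqrt ((r ^ 2 * (1 + r / 2 + Real.sqrt (r ^ 2 / 4 + 1 / (N : ℝ) ^ 2)) / (2 - 4 / (N : ℝ) ^ 2)) ^ 2 / 4 + (r ^ 2 * (4 / (N : ℝ) ^ 2 + 2 * (r / 2 + Real.sqrt (r ^ 2 / 4 + 1 / (N : ℝ) ^ 2)) ^ 2) / (2 - 4 / (N : ℝ) ^ 2))))) + r ^ 2) / 4 + Real.sqrt (((r * ((r ^ 2 * (1 + r / 2 + Real.sqrt (r ^ 2 / 4 + 1 / (N : ℝ) ^ 2)) / (2 - 4 / (N : ℝ) ^ 2)) / 2 + Real.sqrt ((r ^ 2 * (1 + r / 2 + Real.sqrt (r ^ 2 / 4 + 1 / (N : ℝ) ^ 2)) / (2 - 4 / (N : ℝ) ^ 2)) ^ 2 / 4 + (r ^ 2 * (4 / (N : ℝ) ^ 2 +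 2 * (r / 2 + Real.sqrt (r ^ 2 / 4 + 1 / (N : ℝ) ^ 2)) ^ 2) / (2 - 4 / (N : ℝ) ^ 2))))) + r ^ 2) ^ 2 / 16 + r ^ 2 / (N : ℝ) ^ 2)) := by
  have := tau_nonneg hN hr
  positivity

/-- `ω̃(N, ·)` is increasing on `[0, ∞)` (`N ≥ 3`). [folklore] -/
theorem omegaTilde_mono (hN : 3 ≤ N) {r R : ℝ} (hr : 0 ≤ r) (hrR : r ≤ R) : (((r * ((r ^ 2 * (1 + r / 2 + Real.sqrt (r ^ 2 / 4 + 1 / (N : ℝ) ^ 2)) / (2 - 4 / (N : ℝ) ^ 2)) / 2 + Real.sqrt ((r ^ 2 * (1 + r / 2 + Real.sqrt (r ^ 2 / 4 + 1 / (N : ℝ) ^ 2)) / (2 - 4 / (N : ℝ) ^ 2)) ^ 2 / 4 + (r ^ 2 * (4 / (N : ℝ) ^ 2 + 2 * (r / 2 + Real.sqrt (r ^ 2 / 4 + 1 / (N : ℝ) ^ 2)) ^ 2) / (2 - 4 / (N : ℝ) ^ 2))))) + r ^ 2) / 4 + Real.sqrt (((r * ((r ^ 2 * (1 + r / 2 +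 Real.sqrt (r ^ 2 / 4 + 1 / (N : ℝ) ^ 2)) / (2 - 4 / (N : ℝ) ^ 2)) / 2 + Real.sqrt ((r ^ 2 * (1 + r / 2 + Real.sqrt (r ^ 2 / 4 + 1 / (N : ℝ) ^ 2)) / (2 - 4 / (N : ℝ) ^ 2)) ^ 2 / 4 + (r ^ 2 * (4 / (N : ℝ) ^ 2 + 2 * (r / 2 + Real.sqrt (r ^ 2 / 4 + 1 / (N : ℝ) ^ 2)) ^ 2) / (2 - 4 / (N : ℝ) ^ 2))))) + r ^ 2) ^ 2 / 16 + r ^ 2 / (N : ℝ) ^ 2)) ≤ (((R * ((R ^ 2 * (1 + R / 2 + Real.sqrt (R ^ 2 / 4 + 1 / (N : ℝ) ^ 2)) / (2 - 4 / (N : ℝ) ^ 2)) / 2 + Real.sqrt ((R ^ 2 * (1 + R / 2 + Real.sqrt (R ^ 2 / 4 + 1 / (N : ℝ) ^ 2)) / (2 - 4 / (N : ℝ) ^ 2)) ^ 2 / 4 + (R ^ 2 * (4 / (N : ℝ) ^ 2 + 2 * (R / 2 + Real.sqrt (R ^ 2 / 4 + 1 / (N : ℝ) ^ 2)) ^ 2)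 / (2 - 4 / (N : ℝ) ^ 2))))) + R ^ 2) / 4 + Real.sqrt (((R * ((R ^ 2 * (1 + R / 2 + Real.sqrt (R ^ 2 / 4 + 1 / (N : ℝ) ^ 2)) / (2 - 4 / (N : ℝ) ^ 2)) / 2 + Real.sqrt ((R ^ 2 * (1 + R / 2 + Real.sqrt (R ^ 2 / 4 + 1 / (N : ℝ) ^ 2)) / (2 - 4 / (N : ℝ) ^ 2)) ^ 2 / 4 + (R ^ 2 * (4 / (N : ℝ) ^ 2 + 2 * (R / 2 + Real.sqrt (R ^ 2 / 4 + 1 / (N : ℝ) ^ 2)) ^ 2) / (2 - 4 / (N : ℝ) ^ 2))))) + R ^ 2) ^ 2 / 16 + R ^ 2 / (N : ℝ) ^ 2)) := by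
  have ht := tau_mono hN hr hrR
  have ht0 := tau_nonneg hN hr
  have p2 : r ^ 2 ≤ R ^ 2 := pow_le_pow_left₀ hr hrR 2
  have h1 : (r * ((r ^ 2 * (1 + r / 2 + Real.sqrt (r ^ 2 / 4 + 1 / (N : ℝ) ^ 2)) / (2 - 4 / (N : ℝ) ^ 2)) / 2 + Real.sqrt ((r ^ 2 * (1 + r / 2 + Real.sqrt (r ^ 2 / 4 + 1 / (N : ℝ) ^ 2)) / (2 - 4 / (N : ℝ) ^ 2)) ^ 2 / 4 + (r ^ 2 * (4 / (N : ℝ) ^ 2 + 2 * (r / 2 + Real.sqrt (r ^ 2 / 4 + 1 / (N : ℝ) ^ 2)) ^ 2) / (2 - 4 / (N : ℝ) ^ 2))))) + r ^ 2 ≤ (R * ((R ^ 2 * (1 + R / 2 + Real.sqrt (R ^ 2 / 4 + 1 / (N : ℝ) ^ 2)) / (2 - 4 / (N : ℝ) ^ 2)) / 2 + Real.sqrt ((R ^ 2 * (1 + R / 2 + Real.sqrt (R ^ 2 / 4 + 1 / (N : ℝ) ^ 2)) / (2 - 4 / (N : ℝ) ^ 2)) ^ 2 / 4 + (R ^ 2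 * (4 / (N : ℝ) ^ 2 + 2 * (R / 2 + Real.sqrt (R ^ 2 / 4 + 1 / (N : ℝ) ^ 2)) ^ 2) / (2 - 4 / (N : ℝ) ^ 2))))) + R ^ 2 := add_le_add ht p2
  have h0 : 0 ≤ (r * ((r ^ 2 * (1 + r / 2 + Real.sqrt (r ^ 2 / 4 + 1 / (N : ℝ) ^ 2)) / (2 - 4 / (N : ℝ) ^ 2)) / 2 + Real.sqrt ((r ^ 2 * (1 + r / 2 + Real.sqrt (r ^ 2 / 4 + 1 / (N : ℝ) ^ 2)) / (2 - 4 / (N : ℝ) ^ 2)) ^ 2 / 4 + (r ^ 2 * (4 / (N : ℝ) ^ 2 + 2 * (r / 2 + Real.sqrt (r ^ 2 / 4 + 1 / (N : ℝ) ^ 2)) ^ 2) / (2 - 4 / (N : ℝ) ^ 2))))) + r ^ 2 := by positivity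
  have hsq : ((r * ((r ^ 2 * (1 + r / 2 + Real.sqrt (r ^ 2 / 4 + 1 / (N : ℝ) ^ 2)) / (2 - 4 / (N : ℝ) ^ 2)) / 2 + Real.sqrt ((r ^ 2 * (1 + r / 2 + Real.sqrt (r ^ 2 / 4 + 1 / (N : ℝ) ^ 2)) / (2 - 4 / (N : ℝ) ^ 2)) ^ 2 / 4 + (r ^ 2 * (4 / (N : ℝ) ^ 2 + 2 * (r / 2 + Real.sqrt (r ^ 2 / 4 + 1 / (N : ℝ) ^ 2)) ^ 2) / (2 - 4 / (N : ℝ) ^ 2))))) + r ^ 2) ^ 2 ≤ ((R * ((R ^ 2 * (1 + R / 2 + Real.sqrt (R ^ 2 / 4 + 1 / (N : ℝ) ^ 2)) / (2 - 4 / (N : ℝ) ^ 2)) / 2 + Real.sqrt ((R ^ 2 * (1 + R / 2 + Real.sqrt (R ^ 2 / 4 + 1 / (N : ℝ) ^ 2)) / (2 - 4 / (N : ℝ) ^ 2)) ^ 2 / 4 + (R ^ 2 * (4 / (N : ℝ) ^ 2 + 2 * (R / 2 + Real.sqrt (R ^ 2 / 4 + 1 / (N : ℝ) ^ 2)) ^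 2) / (2 - 4 / (N : ℝ) ^ 2))))) + R ^ 2) ^ 2 := pow_le_pow_left₀ h0 h1 2
  have hN' : r ^ 2 / (N : ℝ) ^ 2 ≤ R ^ 2 / (N : ℝ) ^ 2 := div_le_div_of_nonneg_right p2 (by positivity)
  have hs := Real.sqrt_le_sqrt (show ((r * ((r ^ 2 * (1 + r / 2 + Real.sqrt (r ^ 2 / 4 + 1 / (N : ℝ) ^ 2)) / (2 - 4 / (N : ℝ) ^ 2)) / 2 + Real.sqrt ((r ^ 2 * (1 + r / 2 + Real.sqrt (r ^ 2 / 4 + 1 / (N : ℝ) ^ 2)) / (2 - 4 / (N : ℝ) ^ 2)) ^ 2 / 4 + (r ^ 2 * (4 / (N : ℝ) ^ 2 + 2 * (r / 2 + Real.sqrt (r ^ 2 / 4 + 1 / (N : ℝ) ^ 2)) ^ 2) / (2 - 4 / (N : ℝ) ^ 2))))) + r ^ 2) ^ 2 / 16 + r ^ 2 / (N : ℝ) ^ 2 ≤ ((R * ((R ^ 2 * (1 + R / 2 + Real.sqrt (R ^ 2 / 4 + 1 / (N : ℝ) ^ 2)) / (2 - 4 / (N : ℝ) ^ 2)) / 2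 + Real.sqrt ((R ^ 2 * (1 + R / 2 + Real.sqrt (R ^ 2 / 4 + 1 / (N : ℝ) ^ 2)) / (2 - 4 / (N : ℝ) ^ 2)) ^ 2 / 4 + (R ^ 2 * (4 / (N : ℝ) ^ 2 + 2 * (R / 2 + Real.sqrt (R ^ 2 / 4 + 1 / (N : ℝ) ^ 2)) ^ 2) / (2 - 4 / (N : ℝ) ^ 2))))) + R ^ 2) ^ 2 / 16 + R ^ 2 / (N : ℝ) ^ 2 by
    linarith only [hsq, hN'])
  linarith only [h1, hs]

/-! ### The explicit bound -/

/-- **THE LEVEL-TWO COVARIANCE BOUND WITH THE `ω̃` SECOND MOMENT, explicit.**  `N ≥ 3`, `‖B‖_op < 1/2`, `φ` bounded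
measurable `L`-Lipschitz (Frobenius) on `SU(N)`: `|∫ φ · N Re tr(gΔ) dν_B − ∫ φ dν_B ∫ N Re tr(gΔ) dν_B| ≤ K₂QT(N, ‖B‖_op) · L · ‖Δ‖_F`.
[folklore] -/
theorem cov_linear_le_levelTwoQT_explicit (hN : 3 ≤ N) {B : Matrix (Fin N) (Fin N) ℂ} (hB : matrixOpNorm B < 1 / 2)
    (Δ : Matrix (Fin N) (Fin N) ℂ) (φ : SUN N → ℝ) {L : ℝ} (hφm : Measurable φ) (hφb : ∃ C, ∀ s, |φ s| ≤ C)
    (hL : 0 ≤ L) (hφL : ∀ a b, |φ a - φ b| ≤ L * suFrobDist a b) :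
    |∫ s, φ s * ((N : ℝ) * ((s : Matrix (Fin N) (Fin N) ℂ) * Δ).trace.re)
          ∂(haarProbability (SUN N)).tilted (fun g => (N : ℝ) * ((g : Matrix (Fin N) (Fin N) ℂ) * B).trace.re) -
        (∫ s, φ s ∂(haarProbability (SUN N)).tilted (fun g => (N : ℝ) * ((g : Matrix (Fin N) (Fin N) ℂ) * B).trace.re)) *
          ∫ s, (N : ℝ) * ((s : Matrix (Fin N) (Fin N) ℂ) * Δ).trace.re
            ∂(haarProbability (SUN N)).tilted (fun g => (N : ℝ) * ((g : Matrix (Fin N) (Fin N) ℂ) * B).trace.re)| ≤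
      ((N : ℝ) ^ 2 / ((N : ℝ) ^ 2 - 1)) *
        (Real.sqrt ((1 +
            (2 * ((N : ℝ) * (2 * (N : ℝ) - 4 / N) / ((2 * (N : ℝ) - 4 / N) ^ 2 - 4)) *
            (matrixOpNorm B + (matrixOpNorm B ^ 2 / 2 + matrixOpNorm B * Real.sqrt (matrixOpNorm B ^ 2 / 4 + 1 / (N : ℝ) ^ 2)))
          + 2 * (2 * (N : ℝ) / ((2 * (N : ℝ) - 4 / N) ^ 2 - 4)) * N *
            ((matrixOpNorm B ^ 2 / 2 + matrixOpNorm B * Real.sqrt (matrixOpNorm B ^ 2 / 4 + 1 / (N : ℝ) ^ 2))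
              + matrixOpNorm B * (matrixOpNorm B / 2 + Real.sqrt (matrixOpNorm B ^ 2 / 4 + 1 / (N : ℝ) ^ 2)) ^ 2))) / 2)
          + ((N : ℝ) ^ 2 / (2 * ((N : ℝ) ^ 2 - 4))) * matrixOpNorm B + 2 * (((N : ℝ) ^ 2 / (2 * ((N : ℝ) ^ 2 - 4))) + 1 / 4) * (((matrixOpNorm B * ((matrixOpNorm B ^ 2 * (1 + matrixOpNorm B / 2 + Real.sqrt (matrixOpNorm B ^ 2 / 4 + 1 / (N : ℝ) ^ 2)) / (2 - 4 / (N : ℝ) ^ 2)) / 2 + Real.sqrt ((matrixOpNorm B ^ 2 * (1 + matrixOpNorm B / 2 + Real.sqrt (matrixOpNorm B ^ 2 / 4 + 1 / (N : ℝ) ^ 2)) / (2 - 4 / (N : ℝ) ^ 2)) ^ 2 / 4 + (matrixOpNorm B ^ 2 * (4 / (N : ℝ) ^ 2 + 2 * (matrixOpNorm B / 2 + Real.sqrt (matrixOpNorm B ^ 2 / 4 + 1 / (N : ℝ) ^ 2)) ^ 2) / (2 - 4 / (N : ℝ) ^ 2))))) + matrixOpNorm B ^ 2) / 4 + Real.sqrt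 (((matrixOpNorm B * ((matrixOpNorm B ^ 2 * (1 + matrixOpNorm B / 2 + Real.sqrt (matrixOpNorm B ^ 2 / 4 + 1 / (N : ℝ) ^ 2)) / (2 - 4 / (N : ℝ) ^ 2)) / 2 + Real.sqrt ((matrixOpNorm B ^ 2 * (1 + matrixOpNorm B / 2 + Real.sqrt (matrixOpNorm B ^ 2 / 4 + 1 / (N : ℝ) ^ 2)) / (2 - 4 / (N : ℝ) ^ 2)) ^ 2 / 4 + (matrixOpNorm B ^ 2 * (4 / (N : ℝ) ^ 2 + 2 * (matrixOpNorm B / 2 + Real.sqrt (matrixOpNorm B ^ 2 / 4 + 1 / (N : ℝ) ^ 2)) ^ 2) / (2 - 4 / (N : ℝ) ^ 2))))) + matrixOpNorm B ^ 2) ^ 2 / 16 + matrixOpNorm B ^ 2 / (N : ℝ) ^ 2))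
          + (3 * ((N : ℝ) ^ 2 / (2 * ((N : ℝ) ^ 2 - 4))) * matrixOpNorm B ^ 2 + (2 * ((N : ℝ) ^ 2 / (2 * ((N : ℝ) ^ 2 - 4))) + 1 / 4) * (matrixOpNorm B * ((matrixOpNorm B ^ 2 * (1 + matrixOpNorm B / 2 + Real.sqrt (matrixOpNorm B ^ 2 / 4 + 1 / (N : ℝ) ^ 2)) / (2 - 4 / (N : ℝ) ^ 2)) / 2 + Real.sqrt ((matrixOpNorm B ^ 2 * (1 + matrixOpNorm B / 2 + Real.sqrt (matrixOpNorm B ^ 2 / 4 + 1 / (N : ℝ) ^ 2)) / (2 - 4 / (N : ℝ) ^ 2)) ^ 2 / 4 + (matrixOpNorm B ^ 2 * (4 / (N : ℝ) ^ 2 + 2 * (matrixOpNorm B / 2 + Real.sqrt (matrixOpNorm B ^ 2 / 4 + 1 / (N : ℝ) ^ 2)) ^ 2) / (2 - 4 / (N : ℝ) ^ 2)))))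
              + (10 * ((N : ℝ) ^ 2 / (2 * ((N : ℝ) ^ 2 - 4))) + 1 / 2) * matrixOpNorm B * (((matrixOpNorm B * ((matrixOpNorm B ^ 2 * (1 + matrixOpNorm B / 2 + Real.sqrt (matrixOpNorm B ^ 2 / 4 + 1 / (N : ℝ) ^ 2)) / (2 - 4 / (N : ℝ) ^ 2)) / 2 + Real.sqrt ((matrixOpNorm B ^ 2 * (1 + matrixOpNorm B / 2 + Real.sqrt (matrixOpNorm B ^ 2 / 4 + 1 / (N : ℝ) ^ 2)) / (2 - 4 / (N : ℝ) ^ 2)) ^ 2 / 4 + (matrixOpNorm B ^ 2 * (4 / (N : ℝ) ^ 2 + 2 * (matrixOpNorm B / 2 + Real.sqrt (matrixOpNorm B ^ 2 / 4 + 1 / (N : ℝ) ^ 2)) ^ 2) / (2 - 4 / (N : ℝ) ^ 2))))) + matrixOpNorm B ^ 2) / 4 + Real.sqrt (((matrixOpNorm B * ((matrixOpNorm B ^ 2 * (1 + matrixOpNorm B / 2 + Real.sqrt (matrixOpNorm B ^ 2 / 4 + 1 / (N : ℝ) ^ 2)) / (2 - 4 / (N : ℝ) ^ 2)) / 2 +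 Real.sqrt ((matrixOpNorm B ^ 2 * (1 + matrixOpNorm B / 2 + Real.sqrt (matrixOpNorm B ^ 2 / 4 + 1 / (N : ℝ) ^ 2)) / (2 - 4 / (N : ℝ) ^ 2)) ^ 2 / 4 + (matrixOpNorm B ^ 2 * (4 / (N : ℝ) ^ 2 + 2 * (matrixOpNorm B / 2 + Real.sqrt (matrixOpNorm B ^ 2 / 4 + 1 / (N : ℝ) ^ 2)) ^ 2) / (2 - 4 / (N : ℝ) ^ 2))))) + matrixOpNorm B ^ 2) ^ 2 / 16 + matrixOpNorm B ^ 2 / (N : ℝ) ^ 2))) / (1 / 2 - matrixOpNorm B)) * L * frobNorm Δ := by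
  have hN0 : N ≠ 0 := by omega
  have h3 : (3 : ℝ) ≤ N := by exact_mod_cast hN
  have hNpos : (0 : ℝ) < N := by linarith
  have hNne : (N : ℝ) ≠ 0 := hNpos.ne'
  have hr0 := matrixOpNorm_nonneg B
  have hB0 := frobNorm_nonneg B
  have hD0 := frobNorm_nonneg Δ
  have hW0 : 0 ≤ (N : ℝ) * (((matrixOpNorm B * ((matrixOpNorm B ^ 2 * (1 + matrixOpNorm B / 2 + Real.sqrt (matrixOpNorm B ^ 2 / 4 + 1 / (N : ℝ) ^ 2)) / (2 - 4 / (N : ℝ) ^ 2)) / 2 + Real.sqrt ((matrixOpNorm B ^ 2 * (1 + matrixOpNorm B / 2 + Real.sqrt (matrixOpNorm B ^ 2 / 4 + 1 / (N : ℝ) ^ 2)) / (2 - 4 / (N : ℝ) ^ 2)) ^ 2 / 4 + (matrixOpNorm B ^ 2 * (4 / (N : ℝ) ^ 2 + 2 * (matrixOpNorm B / 2 + Real.sqrt (matrixOpNorm B ^ 2 / 4 + 1 / (N : ℝ) ^ 2)) ^ 2) / (2 - 4 / (N : ℝ) ^ 2))))) + matrixOpNorm B ^ 2) / 4 + Real.sqrt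 (((matrixOpNorm B * ((matrixOpNorm B ^ 2 * (1 + matrixOpNorm B / 2 + Real.sqrt (matrixOpNorm B ^ 2 / 4 + 1 / (N : ℝ) ^ 2)) / (2 - 4 / (N : ℝ) ^ 2)) / 2 + Real.sqrt ((matrixOpNorm B ^ 2 * (1 + matrixOpNorm B / 2 + Real.sqrt (matrixOpNorm B ^ 2 / 4 + 1 / (N : ℝ) ^ 2)) / (2 - 4 / (N : ℝ) ^ 2)) ^ 2 / 4 + (matrixOpNorm B ^ 2 * (4 / (N : ℝ) ^ 2 + 2 * (matrixOpNorm B / 2 + Real.sqrt (matrixOpNorm B ^ 2 / 4 + 1 / (N : ℝ) ^ 2)) ^ 2) / (2 - 4 / (N : ℝ) ^ 2))))) + matrixOpNorm B ^ 2) ^ 2 / 16 + matrixOpNorm B ^ 2 / (N : ℝ) ^ 2)) :=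
    mul_nonneg hNpos.le (omegaTilde_nonneg hN hr0)
  have hZ1 := sqrt_integral_normSq_trace_le_sd_omegaTilde hN B
  have hZ2 := frobNorm_mul_sqrt_integral_normSq_trace_le_sd_omegaTilde hN B Δ
  refine (levelTwo_algebraWAQ hN rfl rfl rfl rfl rfl rfl hr0 hB hB0 hD0 hL (frobNorm_le_sqrt_mul_matrixOpNorm B) hW0 hZ1 hZ2
    (sqrt_integral_normSq_quadBB_le_scale hN B) (frobNorm_mul_sqrt_integral_normSq_quadDB_le hN B Δ)
    (sqrt_integral_Gam_upsi_le_omegaPlus hN B Δ) (sqrt_integral_Gam_c3_le_quad hN B Δ)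
    (cov_linear_le_levelTwo hN hB Δ φ hφm hφb hL hφL)).trans (le_of_eq ?_)
  rw [levelTwo_idW1 hNne, levelTwo_idW2 hNne]

/-! ### Monotonicity and the modulus -/

/-- Monotonicity of the `K₂Q`/`K₂QT` SHAPE in its ingredients `A, R, w, τ` (pure real arithmetic; instantiated inside
`oneLinkKRModulus_levelTwoQT` — the concrete 18 kB monotonicity statement is too big to elaborate). [folklore] -/
theorem levelTwoQShape_mono {C A A' E R R' w w' τ τ' : ℝ}
    (hC0 : 0 ≤ C) (hE0 : 0 ≤ E) (hA : A ≤ A') (hR : R ≤ R') (hw : w ≤ w') (hτ : τ ≤ τ')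
    (hR0 : 0 ≤ R) (hw0 : 0 ≤ w) (hτ0 : 0 ≤ τ) (hR' : R' < 1 / 2) :
    C * (A + E * R + 2 * (E + 1 / 4) * w + (3 * E * R ^ 2 + (2 * E + 1 / 4) * τ + (10 * E + 1 / 2) * R * w) / (1 / 2 - R)) ≤
      C * (A' + E * R' + 2 * (E + 1 / 4) * w'
        + (3 * E * R' ^ 2 + (2 * E + 1 / 4) * τ' + (10 * E + 1 / 2) * R' * w') / (1 / 2 - R')) := by
  have hT' : 0 < 1 / 2 - R' := by linarith only [hR']
  have hR'0 : 0 ≤ R' := hR0.trans hR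
  have hw'0 : 0 ≤ w' := hw0.trans hw
  have p2 : R ^ 2 ≤ R' ^ 2 := pow_le_pow_left₀ hR0 hR 2
  have t1 : E * R ≤ E * R' := mul_le_mul_of_nonneg_left hR hE0
  have t2 : 2 * (E + 1 / 4) * w ≤ 2 * (E + 1 / 4) * w' := mul_le_mul_of_nonneg_left hw (by positivity)
  have n1 : 3 * E * R ^ 2 ≤ 3 * E * R' ^ 2 := mul_le_mul_of_nonneg_left p2 (by positivity)
  have n2 : (10 * E + 1 / 2) * R * w ≤ (10 * E + 1 / 2) * R' * w' :=
    mul_le_mul (mul_le_mul_of_nonneg_left hR (by positivity)) hw hw0 (by positivity)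
  have n3 : (2 * E + 1 / 4) * τ ≤ (2 * E + 1 / 4) * τ' := mul_le_mul_of_nonneg_left hτ (by positivity)
  have hnum0 : 0 ≤ 3 * E * R ^ 2 + (2 * E + 1 / 4) * τ + (10 * E + 1 / 2) * R * w := by positivity
  have hnum : 3 * E * R ^ 2 + (2 * E + 1 / 4) * τ + (10 * E + 1 / 2) * R * w ≤
      3 * E * R' ^ 2 + (2 * E + 1 / 4) * τ' + (10 * E + 1 / 2) * R' * w' := by linarith only [n1, n2, n3]
  have hfrac := div_le_div₀ (hnum0.trans hnum) hnum hT' (by linarith only [hR] : 1 / 2 - R' ≤ 1 / 2 - R)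
  exact mul_le_mul_of_nonneg_left (by linarith only [hA, t1, t2, hfrac]) hC0

set_option maxHeartbeats 400000 in
/-- **THE LEVEL-TWO ONE-LINK KANTOROVICH–RUBINSTEIN MODULUS WITH THE `ω̃` SECOND MOMENT, EVERY `SU(N)`, `N ≥ 3`,
HYPOTHESIS-FREE**: for `R < 1/2`, `OneLinkKRModulus N R (K₂QT(N,R))`.  Proof: `cov_linear_le_levelTwoQT_explicit` along the segment
`B_t = B + t(B' − B)` (convexity of the ball, `levelTwoQShape_mono` with `omegaTilde_mono`, `tau_mono`, `omegaPlus_mono`) and the tilt-interpolation lemma `abs_integral_tilted_add_sub_le_of_cov`.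
[cite: arXiv220412737, Lemma 4.1 and Rem. 1.3] -/
theorem oneLinkKRModulus_levelTwoQT (hN : 3 ≤ N) {R : ℝ} (hR : R < 1 / 2) :
    OneLinkKRModulus N R
      (((N : ℝ) ^ 2 / ((N : ℝ) ^ 2 - 1)) *
        (Real.sqrt ((1 +
            (2 * ((N : ℝ) * (2 * (N : ℝ) - 4 / N) / ((2 * (N : ℝ) - 4 / N) ^ 2 - 4)) *
            (R + (R ^ 2 / 2 + R * Real.sqrt (R ^ 2 / 4 + 1 / (N : ℝ) ^ 2)))
          + 2 * (2 * (N : ℝ) / ((2 * (N : ℝ) - 4 / N) ^ 2 - 4)) * N *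
            ((R ^ 2 / 2 + R * Real.sqrt (R ^ 2 / 4 + 1 / (N : ℝ) ^ 2))
              + R * (R / 2 + Real.sqrt (R ^ 2 / 4 + 1 / (N : ℝ) ^ 2)) ^ 2))) / 2)
          + ((N : ℝ) ^ 2 / (2 * ((N : ℝ) ^ 2 - 4))) * R + 2 * (((N : ℝ) ^ 2 / (2 * ((N : ℝ) ^ 2 - 4))) + 1 / 4) * (((R * ((R ^ 2 * (1 + R / 2 + Real.sqrt (R ^ 2 / 4 + 1 / (N : ℝ) ^ 2)) / (2 - 4 / (N : ℝ) ^ 2)) / 2 + Real.sqrt ((R ^ 2 * (1 + R / 2 + Real.sqrt (R ^ 2 / 4 + 1 / (N : ℝ) ^ 2)) / (2 - 4 / (N : ℝ) ^ 2)) ^ 2 / 4 + (R ^ 2 * (4 / (N : ℝ) ^ 2 + 2 * (R / 2 + Real.sqrt (R ^ 2 / 4 + 1 / (N : ℝ) ^ 2)) ^ 2) / (2 - 4 / (N : ℝ) ^ 2))))) + R ^ 2) / 4 + Real.sqrt (((R * ((R ^ 2 * (1 + R / 2 + Real.sqrt (R ^ 2 / 4 + 1 / (N : ℝ) ^ 2))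 / (2 - 4 / (N : ℝ) ^ 2)) / 2 + Real.sqrt ((R ^ 2 * (1 + R / 2 + Real.sqrt (R ^ 2 / 4 + 1 / (N : ℝ) ^ 2)) / (2 - 4 / (N : ℝ) ^ 2)) ^ 2 / 4 + (R ^ 2 * (4 / (N : ℝ) ^ 2 + 2 * (R / 2 + Real.sqrt (R ^ 2 / 4 + 1 / (N : ℝ) ^ 2)) ^ 2) / (2 - 4 / (N : ℝ) ^ 2))))) + R ^ 2) ^ 2 / 16 + R ^ 2 / (N : ℝ) ^ 2))
          + (3 * ((N : ℝ) ^ 2 / (2 * ((N : ℝ) ^ 2 - 4))) * R ^ 2 + (2 * ((N : ℝ) ^ 2 / (2 * ((N : ℝ) ^ 2 - 4))) + 1 / 4) * (R * ((R ^ 2 * (1 + R / 2 + Real.sqrt (R ^ 2 / 4 + 1 / (N : ℝ) ^ 2)) / (2 - 4 / (N : ℝ) ^ 2)) / 2 + Real.sqrt ((R ^ 2 * (1 + R / 2 + Real.sqrt (R ^ 2 / 4 + 1 / (N : ℝ) ^ 2)) / (2 - 4 / (N : ℝ) ^ 2)) ^ 2 / 4 + (R ^ 2 * (4 / (N : ℝ)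 ^ 2 + 2 * (R / 2 + Real.sqrt (R ^ 2 / 4 + 1 / (N : ℝ) ^ 2)) ^ 2) / (2 - 4 / (N : ℝ) ^ 2)))))
              + (10 * ((N : ℝ) ^ 2 / (2 * ((N : ℝ) ^ 2 - 4))) + 1 / 2) * R * (((R * ((R ^ 2 * (1 + R / 2 + Real.sqrt (R ^ 2 / 4 + 1 / (N : ℝ) ^ 2)) / (2 - 4 / (N : ℝ) ^ 2)) / 2 + Real.sqrt ((R ^ 2 * (1 + R / 2 + Real.sqrt (R ^ 2 / 4 + 1 / (N : ℝ) ^ 2)) / (2 - 4 / (N : ℝ) ^ 2)) ^ 2 / 4 + (R ^ 2 * (4 / (N : ℝ) ^ 2 + 2 * (R / 2 + Real.sqrt (R ^ 2 / 4 + 1 / (N : ℝ) ^ 2)) ^ 2) / (2 - 4 / (N : ℝ) ^ 2))))) + R ^ 2) / 4 + Real.sqrt (((R * ((R ^ 2 * (1 + R / 2 + Real.sqrt (R ^ 2 / 4 + 1 / (N : ℝ) ^ 2)) / (2 - 4 / (N : ℝ) ^ 2)) / 2 + Real.sqrt ((R ^ 2 * (1 + R / 2 + Real.sqrt (R ^ 2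 / 4 + 1 / (N : ℝ) ^ 2)) / (2 - 4 / (N : ℝ) ^ 2)) ^ 2 / 4 + (R ^ 2 * (4 / (N : ℝ) ^ 2 + 2 * (R / 2 + Real.sqrt (R ^ 2 / 4 + 1 / (N : ℝ) ^ 2)) ^ 2) / (2 - 4 / (N : ℝ) ^ 2))))) + R ^ 2) ^ 2 / 16 + R ^ 2 / (N : ℝ) ^ 2))) / (1 / 2 - R))) := by
  classical
  intro B B' hB hB' φ L hφm hφb hL hφL
  have hN0 : N ≠ 0 := by omega
  have hNpos : (0 : ℝ) < N := Nat.cast_pos.2 (Nat.pos_of_ne_zero hN0)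
  set f : SUN N → ℝ := fun g => (N : ℝ) * ((g : Matrix (Fin N) (Fin N) ℂ) * B).trace.re with hf
  set w : SUN N → ℝ := fun g => (N : ℝ) * ((g : Matrix (Fin N) (Fin N) ℂ) * (B' - B)).trace.re with hw
  have hfw : (fun g : SUN N => (N : ℝ) * ((g : Matrix (Fin N) (Fin N) ℂ) * B').trace.re) = fun g => f g + w g := by
    funext g
    simp only [hf, hw, Matrix.mul_sub, trace_sub, Complex.sub_re]
    ring
  rw [hfw, abs_sub_comm]
  have hfm : Measurable f := (continuous_const.mul (continuous_re_trace_su_mul B)).measurable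
  have hwm : Measurable w := (continuous_const.mul (continuous_re_trace_su_mul (B' - B))).measurable
  have hfb : ∃ C, ∀ s, |f s| ≤ C := ⟨(N : ℝ) * (Real.sqrt N * frobNorm B), fun s => by
    simp only [hf]
    rw [abs_mul, abs_of_nonneg hNpos.le]
    exact mul_le_mul_of_nonneg_left (abs_re_trace_su_mul_le s B) hNpos.le⟩
  have hwb : ∀ s, |w s| ≤ (N : ℝ) * (Real.sqrt N * frobNorm (B' - B)) := fun s => by
    simp only [hw]
    rw [abs_mul, abs_of_nonneg hNpos.le]
    exact mul_le_mul_of_nonneg_left (abs_re_trace_su_mul_le s _) hNpos.le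
  have key := abs_integral_tilted_add_sub_le_of_cov (μ := haarProbability (SUN N))
    (A := (((N : ℝ) ^ 2 / ((N : ℝ) ^ 2 - 1)) *
        (Real.sqrt ((1 +
            (2 * ((N : ℝ) * (2 * (N : ℝ) - 4 / N) / ((2 * (N : ℝ) - 4 / N) ^ 2 - 4)) *
            (R + (R ^ 2 / 2 + R * Real.sqrt (R ^ 2 / 4 + 1 / (N : ℝ) ^ 2)))
          + 2 * (2 * (N : ℝ) / ((2 * (N : ℝ) - 4 / N) ^ 2 - 4)) * N *
            ((R ^ 2 / 2 + R * Real.sqrt (R ^ 2 / 4 + 1 / (N : ℝ) ^ 2))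
              + R * (R / 2 + Real.sqrt (R ^ 2 / 4 + 1 / (N : ℝ) ^ 2)) ^ 2))) / 2)
          + ((N : ℝ) ^ 2 / (2 * ((N : ℝ) ^ 2 - 4))) * R + 2 * (((N : ℝ) ^ 2 / (2 * ((N : ℝ) ^ 2 - 4))) + 1 / 4) * (((R * ((R ^ 2 * (1 + R / 2 + Real.sqrt (R ^ 2 / 4 + 1 / (N : ℝ) ^ 2)) / (2 - 4 / (N : ℝ) ^ 2)) / 2 + Real.sqrt ((R ^ 2 * (1 + R / 2 + Real.sqrt (R ^ 2 / 4 + 1 / (N : ℝ) ^ 2)) / (2 - 4 / (N : ℝ) ^ 2)) ^ 2 / 4 + (R ^ 2 * (4 / (N : ℝ) ^ 2 + 2 * (R / 2 + Real.sqrt (R ^ 2 / 4 + 1 / (N : ℝ) ^ 2)) ^ 2) / (2 - 4 / (N : ℝ) ^ 2))))) + R ^ 2) / 4 + Real.sqrt (((R * ((R ^ 2 * (1 + R / 2 + Real.sqrt (R ^ 2 / 4 + 1 / (N : ℝ) ^ 2)) / (2 - 4 / (N : ℝ) ^ 2)) / 2 + Real.sqrt ((R ^ 2 * (1 + R / 2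 + Real.sqrt (R ^ 2 / 4 + 1 / (N : ℝ) ^ 2)) / (2 - 4 / (N : ℝ) ^ 2)) ^ 2 / 4 + (R ^ 2 * (4 / (N : ℝ) ^ 2 + 2 * (R / 2 + Real.sqrt (R ^ 2 / 4 + 1 / (N : ℝ) ^ 2)) ^ 2) / (2 - 4 / (N : ℝ) ^ 2))))) + R ^ 2) ^ 2 / 16 + R ^ 2 / (N : ℝ) ^ 2))
          + (3 * ((N : ℝ) ^ 2 / (2 * ((N : ℝ) ^ 2 - 4))) * R ^ 2 + (2 * ((N : ℝ) ^ 2 / (2 * ((N : ℝ) ^ 2 - 4))) + 1 / 4) * (R * ((R ^ 2 * (1 + R / 2 + Real.sqrt (R ^ 2 / 4 + 1 / (N : ℝ) ^ 2)) / (2 - 4 / (N : ℝ) ^ 2)) / 2 + Real.sqrt ((R ^ 2 * (1 + R / 2 + Real.sqrt (R ^ 2 / 4 + 1 / (N : ℝ) ^ 2)) / (2 - 4 / (N : ℝ) ^ 2)) ^ 2 / 4 + (R ^ 2 * (4 / (N : ℝ) ^ 2 + 2 * (R / 2 + Real.sqrt (R ^ 2 / 4 + 1 / (N : ℝ) ^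 2)) ^ 2) / (2 - 4 / (N : ℝ) ^ 2)))))
              + (10 * ((N : ℝ) ^ 2 / (2 * ((N : ℝ) ^ 2 - 4))) + 1 / 2) * R * (((R * ((R ^ 2 * (1 + R / 2 + Real.sqrt (R ^ 2 / 4 + 1 / (N : ℝ) ^ 2)) / (2 - 4 / (N : ℝ) ^ 2)) / 2 + Real.sqrt ((R ^ 2 * (1 + R / 2 + Real.sqrt (R ^ 2 / 4 + 1 / (N : ℝ) ^ 2)) / (2 - 4 / (N : ℝ) ^ 2)) ^ 2 / 4 + (R ^ 2 * (4 / (N : ℝ) ^ 2 + 2 * (R / 2 + Real.sqrt (R ^ 2 / 4 + 1 / (N : ℝ) ^ 2)) ^ 2) / (2 - 4 / (N : ℝ) ^ 2))))) + R ^ 2) / 4 + Real.sqrt (((R * ((R ^ 2 * (1 + R / 2 + Real.sqrt (R ^ 2 / 4 + 1 / (N : ℝ) ^ 2)) / (2 - 4 / (N : ℝ) ^ 2)) / 2 + Real.sqrt ((R ^ 2 * (1 + R / 2 + Real.sqrt (R ^ 2 / 4 + 1 / (N : ℝ) ^ 2)) / (2 - 4 / (N : ℝ) ^ 2)) ^ 2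 / 4 + (R ^ 2 * (4 / (N : ℝ) ^ 2 + 2 * (R / 2 + Real.sqrt (R ^ 2 / 4 + 1 / (N : ℝ) ^ 2)) ^ 2) / (2 - 4 / (N : ℝ) ^ 2))))) + R ^ 2) ^ 2 / 16 + R ^ 2 / (N : ℝ) ^ 2))) / (1 / 2 - R))) * L * frobNorm (B' - B))
    hfm hfb hwm hwb hφm hφb ?_
  · rw [frobNorm_sub_comm] at key
    exact key
  · intro t ht
    set Bt : Matrix (Fin N) (Fin N) ℂ := B + (t : ℂ) • (B' - B) with hBt
    have hft : (fun u : SUN N => f u + t * w u) =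
        fun g : SUN N => (N : ℝ) * ((g : Matrix (Fin N) (Fin N) ℂ) * Bt).trace.re := by
      funext g
      simp only [hf, hw, hBt, Matrix.mul_add, Matrix.mul_smul, trace_add, trace_smul, Complex.add_re, smul_eq_mul,
        Complex.re_ofReal_mul]
      ring
    have hBt_le : matrixOpNorm Bt ≤ R := by
      have h1 : Bt = ((1 - t : ℝ) : ℂ) • B + ((t : ℝ) : ℂ) • B' := by
        rw [hBt]; push_cast; simp only [smul_sub, sub_smul, one_smul]; abel
      rw [h1]
      calc matrixOpNorm (((1 - t : ℝ) : ℂ) • B + ((t : ℝ) : ℂ) • B')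
          ≤ matrixOpNorm (((1 - t : ℝ) : ℂ) • B) + matrixOpNorm (((t : ℝ) : ℂ) • B') := matrixOpNorm_add_le _ _
        _ = (1 - t) * matrixOpNorm B + t * matrixOpNorm B' := by
            rw [matrixOpNorm_smul, matrixOpNorm_smul, Complex.norm_real, Complex.norm_real, Real.norm_eq_abs,
              Real.norm_eq_abs, abs_of_nonneg (by linarith [ht.2]), abs_of_nonneg ht.1]
        _ ≤ (1 - t) * R + t * R :=
            add_le_add (mul_le_mul_of_nonneg_left hB (by linarith [ht.2])) (mul_le_mul_of_nonneg_left hB' ht.1)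
        _ = R := by ring
    have hBt_lt : matrixOpNorm Bt < 1 / 2 := lt_of_le_of_lt hBt_le hR
    have hcov := cov_linear_le_levelTwoQT_explicit hN hBt_lt (B' - B) φ hφm hφb hL hφL
    rw [← hft] at hcov
    refine hcov.trans (mul_le_mul_of_nonneg_right (mul_le_mul_of_nonneg_right ?_ hL) (frobNorm_nonneg _))
    have h3 : (3 : ℝ) ≤ N := by exact_mod_cast hN
    have hr0 := matrixOpNorm_nonneg Bt
    have hC0 : 0 ≤ (N : ℝ) ^ 2 / ((N : ℝ) ^ 2 - 1) := div_nonneg (by positivity) (by nlinarith only [h3])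
    have hE0 : 0 ≤ (N : ℝ) ^ 2 / (2 * ((N : ℝ) ^ 2 - 4)) := div_nonneg (by positivity) (by nlinarith only [h3])
    exact levelTwoQShape_mono hC0 hE0
      (Real.sqrt_le_sqrt (div_le_div_of_nonneg_right (add_le_add (le_refl (1 : ℝ)) (omegaPlus_mono hN hr0 hBt_le)) (by norm_num)))
      hBt_le (omegaTilde_mono hN hr0 hBt_le) (tau_mono hN hr0 hBt_le) hr0 (omegaTilde_nonneg hN hr0) (tau_nonneg hN hr0) hR

end Summit.Ventures.YMGap.OneLinkEigen
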